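import Literature.NumberTheory.QuadraticForms.HilbertReciprocityFiniteness
import Literature.RingTheory.DiscreteValuationRing.AdicCompletionResidueField
import HarnessLib

/-!
# The Hilbert symbol at a non-dyadic place: explicit values

Topic `NumberTheory/QuadraticForms`; namespace `Literature`. Companion ("proofs") file of
`HilbertSymbol.lean` continuing `HilbertReciprocityFiniteness.lean`; all declarations are fully
proved theorems. Let `A` be a Dedekind domain with fraction field `K`, `v` a finite place with
`2 ∉ v` (non-dyadic), `π ∈ A` a uniformiser at `v` (`v(π) = 1` additively) and `a b ∈ A ∖ v`
(units at `v`). The symbol `( , )_v` is computed in `K_v = v.adicCompletion K`. Then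
(O'Meara §63B, Example 63:12 and Cor. 63:11a; Serre, *A Course in Arithmetic*, III.1 Thm. 1 for
`K = ℚ`):

* `(a, b)_v = 1` (`hilbertSymbol_eq_one_of_not_mem`, previous file);
* `isSquare_algebraMap_adicCompletion_iff` : `b` is a square in `K_v` iff it is a square in the
  residue field `A ⧸ v` (Hensel; "local square theorem" at a non-dyadic place, O'Meara 63:1a);
* `hilbertSymbol_uniformizer_mul_iff` : `(π a, b)_v = 1` iff `b` is a square mod `v`
  (O'Meara 63:12: "`(π, δ)_𝔭 = 1` iff `δ` is a square"; for `K = ℚ` this is the Legendre symbol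
  `(b / p)`);
* `hilbertSymbol_uniformizer_mul_uniformizer_mul_iff` : `(π a, π b)_v = 1` iff `-a b` is a square
  mod `v`;

together with the general identities `(a, -a b)_F = (a, b)_F`, `(a, -a)_F = 1`, `(a, a)_F =
(a, -1)_F` over any field with `2 ≠ 0` (Serre III.1 Prop. 2 (ii), (iv)). Since `( , )_v` only
depends on square classes (`hilbertSymbol_mul_sq_left/right`), these rules evaluate `(a, b)_v`
for all `a b ∈ K×` at every non-dyadic place.

Relation to `HilbertSymbolLocal.lean` (sibling file, number fields, stated for units and
uniformisers of the local ring `𝒪[K_v]` with residues in `𝓀[K_v]`): the present file works over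
an arbitrary Dedekind domain `A` with *global* data — `a, b, π ∈ A` and square classes in the
residue field `A ⧸ v` of `A` — which is the form needed to evaluate the symbols of rational
numbers at `v ↔ p` through `ℤ ⧸ p` and Legendre symbols (Serre III Thm. 1 for `K = ℚ`); the
bridge `A ⧸ v ≃+* 𝓀[K_v]` is `IsDedekindDomain.HeightOneSpectrum.residueFieldEquiv`
(`Literature/RingTheory/DiscreteValuationRing/AdicCompletionResidueField.lean`).

## References

* O. T. O'Meara, *Introduction to quadratic forms*, Grundlehren 117, Springer (1963), §63
  (63:1a, Example 63:12, PDF pp. 163, 170).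
* J.-P. Serre, *A Course in Arithmetic*, GTM 7, Springer (1973), Ch. III §1 (Prop. 2, Thm. 1).
-/

noncomputable section

open IsDedekindDomain Polynomial WithZero

namespace Literature.NumberTheory.QuadraticForms

/-! ### Identities over a field -/

section Field

variable {F : Type*} [Field F]

/-- `(a, -a)_F = 1` for `a ≠ 0` in a field with `2 ≠ 0`: `a x² - a y² = 1` with
`x = (1 + a⁻¹)/2`, `y = (1 - a⁻¹)/2` (O'Meara §63B; Serre III.1 Prop. 2 (ii)). [folklore] -/
theorem hilbertSymbol_neg_self_right [NeZero (2 : F)] {a : F} (ha : a ≠ 0) :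
    hilbertSymbol F a (-a) = 1 := by
  have h2 : (2 : F) ≠ 0 := two_ne_zero
  refine (hilbertSymbol_eq_one_iff _ _).2 ⟨(1 + a⁻¹) / 2, (1 - a⁻¹) / 2, ?_⟩
  field_simp
  ring

/-- If `(a, b)_F = 1` then `(a, -a b)_F = 1` (`a ≠ 0`, `2 ≠ 0`): from `a x² + b y² = 1` with
`x ≠ 0` one gets `a X² - a b Y² = 1` for `X = 1/(a x)`, `Y = y/(a x)`; if `x = 0` then `b` is a
square and `(a, -a b) = (a, -a) = 1`. [folklore] -/
theorem hilbertSymbol_neg_mul_eq_one [NeZero (2 : F)] {a b : F} (ha : a ≠ 0)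
    (h : hilbertSymbol F a b = 1) : hilbertSymbol F a (-(a * b)) = 1 := by
  obtain ⟨x, y, hxy⟩ := (hilbertSymbol_eq_one_iff _ _).1 h
  by_cases hx : x = 0
  · subst hx
    have hy : y ≠ 0 := by rintro rfl; simp at hxy
    have hb : b = (y⁻¹) ^ 2 := by field_simp; linear_combination hxy
    rw [hb, show -(a * y⁻¹ ^ 2) = -a * y⁻¹ ^ 2 by ring,
      hilbertSymbol_mul_sq_right _ _ (inv_ne_zero hy)]
    exact hilbertSymbol_neg_self_right ha
  · refine (hilbertSymbol_eq_one_iff _ _).2 ⟨(a * x)⁻¹, y * (a * x)⁻¹, ?_⟩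
    have hax : a * x ≠ 0 := mul_ne_zero ha hx
    rw [← sub_eq_zero]
    have key : a * (a * x)⁻¹ ^ 2 + -(a * b) * (y * (a * x)⁻¹) ^ 2 - 1 =
        (a - a * b * y ^ 2 - (a * x) ^ 2) * ((a * x) ^ 2)⁻¹ := by
      field_simp
      ring
    rw [key, mul_eq_zero]
    left
    linear_combination (-a) * hxy

/-- `(a, -a b)_F = (a, b)_F` for `a ≠ 0` in a field with `2 ≠ 0` (apply
`hilbertSymbol_neg_mul_eq_one` twice: `-a (-a b) = a² b`; O'Meara §63B, Serre III.1 Prop. 2).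
[folklore] -/
theorem hilbertSymbol_neg_mul_right [NeZero (2 : F)] {a : F} (ha : a ≠ 0) (b : F) :
    hilbertSymbol F a (-(a * b)) = hilbertSymbol F a b := by
  rcases hilbertSymbol_eq_one_or_eq_neg_one a b with h | h
  · rw [h, hilbertSymbol_neg_mul_eq_one ha h]
  · rw [h, ← hilbertSymbol_ne_one_iff]
    intro h'
    have h'' := hilbertSymbol_neg_mul_eq_one ha h'
    rw [show -(a * -(a * b)) = b * a ^ 2 by ring, hilbertSymbol_mul_sq_right _ _ ha, h] at h''
    norm_num at h''

/-- `(a, a)_F = (a, -1)_F` for `a ≠ 0`, `2 ≠ 0` (the case `b = -1` of `(a, -a b) = (a, b)`).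
[folklore] -/
theorem hilbertSymbol_self_right [NeZero (2 : F)] {a : F} (ha : a ≠ 0) :
    hilbertSymbol F a a = hilbertSymbol F a (-1) := by
  rw [← hilbertSymbol_neg_mul_right ha (-1)]
  ring_nf

end Field

/-! ### Units and uniformisers at a non-dyadic place -/

section Local

variable {A : Type*} [CommRing A] [IsDedekindDomain A] (K : Type*) [Field K] [Algebra A K]
  [IsFractionRing A K] (v : HeightOneSpectrum A)

/-- The valuation on `K_v` of (the image of) `r ∈ A` is its `v`-adic valuation. [folklore] -/
theorem valued_algebraMap (r : A) :
    Valued.v (algebraMap A (v.adicCompletion K) r) = v.intValuation r := by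
  rw [HeightOneSpectrum.valuedAdicCompletion_eq_valuation, HeightOneSpectrum.valuation_of_algebraMap]

/-- The valuation on `K_v` of `r ∈ A` is `≤ 1`. [folklore] -/
theorem valued_algebraMap_le_one (r : A) : Valued.v (algebraMap A (v.adicCompletion K) r) ≤ 1 := by
  rw [valued_algebraMap K v]
  exact HeightOneSpectrum.intValuation_le_one v r

/-- The valuation on `K_v` of `r ∈ A` is `< 1` iff `r ∈ v`. [folklore] -/
theorem valued_algebraMap_lt_one_iff (r : A) :
    Valued.v (algebraMap A (v.adicCompletion K) r) < 1 ↔ r ∈ v.asIdeal := by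
  rw [valued_algebraMap K v]
  exact HeightOneSpectrum.intValuation_lt_one_iff_mem v r

/-- The valuation on `K_v` of `r ∈ A ∖ v` is `1`. [folklore] -/
theorem valued_algebraMap_eq_one {r : A} (hr : r ∉ v.asIdeal) :
    Valued.v (algebraMap A (v.adicCompletion K) r) = 1 := by
  rw [valued_algebraMap K v]
  exact HeightOneSpectrum.intValuation_eq_one_iff.2 hr

/-- Elements of `A ∖ v` are non-zero in `K_v`. [folklore] -/
theorem algebraMap_adicCompletion_ne_zero {r : A} (hr : r ∉ v.asIdeal) :
    algebraMap A (v.adicCompletion K) r ≠ 0 := by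
  intro h0
  have h := valued_algebraMap_eq_one K v hr
  rw [h0, map_zero] at h
  exact zero_ne_one h

/-- Density of `A` in `O_v` in valuation form: every `y ∈ K_v` with `v(y) ≤ 1` is within
distance `< 1` of (the image of) some `c ∈ A` (`exists_sub_algebraMap_mem_maximalIdeal`).
[folklore] -/
theorem exists_valued_sub_algebraMap_lt_one {y : v.adicCompletion K} (hy : Valued.v y ≤ 1) :
    ∃ c : A, Valued.v (y - algebraMap A (v.adicCompletion K) c) < 1 := by
  obtain ⟨c, hc⟩ := HeightOneSpectrum.exists_sub_algebraMap_mem_maximalIdeal K v ⟨y, hy⟩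
  rw [IsLocalRing.mem_maximalIdeal, mem_nonunits_iff,
    HeightOneSpectrum.adicCompletionIntegers.isUnit_iff_valued_eq_one] at hc
  refine ⟨c, lt_of_le_of_ne ?_ hc⟩
  exact le_trans (Valuation.map_sub _ _ _) (max_le hy (valued_algebraMap_le_one K v c))

/-- **A `v`-unit is a square in `K_v` iff it is a square modulo `v`** (`v` non-dyadic; O'Meara
63:1a, the non-dyadic case of the Local Square Theorem). `⇐`: Hensel's lemma for `X² - b` at a
lift `c ∉ v` of a square root (`f'(c) = 2c` is a unit). `⇒`: if `b = z²` in `K_v` then `v(z) = 1`;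
choose `c ∈ A` with `v(z - c) < 1` (density); then `b - c² = (z - c)(z + c)` has valuation `< 1`,
i.e. `b ≡ c² (mod v)`. [cite: Omeara1963, §63 Example 63:12] -/
theorem isSquare_algebraMap_adicCompletion_iff (h2 : (2 : A) ∉ v.asIdeal) {b : A}
    (hb : b ∉ v.asIdeal) :
    IsSquare (algebraMap A (v.adicCompletion K) b) ↔ IsSquare (Ideal.Quotient.mk v.asIdeal b) := by
  haveI : v.asIdeal.IsPrime := v.isPrime
  set O := v.adicCompletionIntegers K with hO
  constructor
  · rintro ⟨z, hz⟩
    -- `v(z) = 1`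
    have hz1 : Valued.v z = 1 := by
      have h := valued_algebraMap_eq_one K v hb
      rw [hz, map_mul] at h
      have hz0 : Valued.v z ≠ 0 := fun h0 ↦ by rw [h0, mul_zero] at h; exact zero_ne_one h
      rw [← exp_log hz0, ← exp_add, ← exp_zero, exp_inj] at h
      rw [← exp_log hz0, ← exp_zero, exp_inj]
      omega
    obtain ⟨c, hc⟩ := exists_valued_sub_algebraMap_lt_one K v hz1.le
    -- `b - c² = (z - c)(z + c)` has valuation `< 1`
    have hmem : b - c ^ 2 ∈ v.asIdeal := by
      rw [← valued_algebraMap_lt_one_iff K v, map_sub, map_pow, hz,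
        show z * z - algebraMap A (v.adicCompletion K) c ^ 2 =
          (z - algebraMap A _ c) * (z + algebraMap A _ c) by ring, map_mul]
      have hadd : Valued.v (z + algebraMap A (v.adicCompletion K) c) ≤ 1 :=
        le_trans (Valuation.map_add _ _ _) (max_le hz1.le (valued_algebraMap_le_one K v c))
      calc Valued.v (z - algebraMap A _ c) * Valued.v (z + algebraMap A _ c)
          ≤ Valued.v (z - algebraMap A _ c) * 1 := by gcongr
        _ < 1 := by rw [mul_one]; exact hc
    refine ⟨Ideal.Quotient.mk v.asIdeal c, ?_⟩
    rw [← map_mul, Ideal.Quotient.eq, ← sq]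
    exact hmem
  · rintro ⟨c₀, hc₀⟩
    obtain ⟨c, rfl⟩ := Ideal.Quotient.mk_surjective c₀
    have hmem : c ^ 2 - b ∈ v.asIdeal := by
      rw [← Ideal.Quotient.eq, map_pow, sq, ← hc₀]
    have hc : c ∉ v.asIdeal := by
      intro hc
      apply hb
      have := Ideal.sub_mem _ (Ideal.pow_mem_of_mem _ hc 2 two_pos) hmem
      rwa [sub_sub_cancel] at this
    -- Hensel for `X² - b` at `c`
    set ι : A →+* O := algebraMap A O with hι
    set f : O[X] := X ^ 2 - C (ι b) with hf
    have hf₁ : f.eval (ι c) = ι (c ^ 2 - b) := by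
      simp only [hf, eval_sub, eval_pow, eval_X, eval_C, map_sub, map_pow]
    have hf₂ : f.derivative.eval (ι c) = ι (2 * c) := by
      have hd : f.derivative = C (2 : O) * X := by
        rw [hf, derivative_sub, derivative_X_pow, derivative_C, sub_zero]
        norm_num
      rw [hd, eval_mul, eval_C, eval_X, map_mul, map_ofNat]
    have h2c : 2 * c ∉ v.asIdeal := fun h ↦ (Ideal.IsPrime.mem_or_mem ‹_› h).elim h2 hc
    have hunit : IsUnit (ι (2 * c)) := by
      rw [hι, HeightOneSpectrum.adicCompletionIntegers.isUnit_iff_valued_eq_one]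
      exact valued_algebraMap_eq_one K v h2c
    obtain ⟨x, hx, -⟩ := HenselianLocalRing.exists_isRoot_of_isUnit_derivative f (ι c)
      (hf₁ ▸ algebraMap_mem_maximalIdeal_adicCompletionIntegers_of_mem K v hmem) (hf₂ ▸ hunit)
    have hroot : x ^ 2 = ι b := by
      have := hx.eq_zero
      simp only [hf, eval_sub, eval_pow, eval_X, eval_C] at this
      exact sub_eq_zero.1 this
    refine ⟨algebraMap O (v.adicCompletion K) x, ?_⟩
    rw [← sq, ← map_pow, hroot, hι, ← IsScalarTower.algebraMap_apply]

/-- For `b ∈ A ∖ v` a square mod `v` (`v` non-dyadic), `(a, b)_v = 1` for every `a ∈ K_v`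
(`b` is a non-zero square in `K_v`). [folklore] -/
theorem hilbertSymbol_eq_one_of_isSquare_residue (h2 : (2 : A) ∉ v.asIdeal) {b : A}
    (hb : b ∉ v.asIdeal) (hsq : IsSquare (Ideal.Quotient.mk v.asIdeal b))
    (a : v.adicCompletion K) :
    hilbertSymbol (v.adicCompletion K) a (algebraMap A _ b) = 1 := by
  rw [hilbertSymbol_comm]
  exact hilbertSymbol_eq_one_of_isSquare ((isSquare_algebraMap_adicCompletion_iff K v h2 hb).2
    hsq) (algebraMap_adicCompletion_ne_zero K v hb) a

/-- **Valuation analysis**: if `p x² + b y² = 1` in `K_v` with `v(p) = 1` (additively: `p` a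
uniformiser) and `b ∈ A ∖ v`, then `b` is a square mod `v`. Indeed `v(p x²)` is odd and
`v(b y²)` even (additively), so `y` is a unit and `p x² ∈ 𝔪_v`; approximating `y` by `c ∈ A`
gives `b c² ≡ b y² ≡ 1 (mod 𝔪_v)`, i.e. `b ≡ (c⁻¹)² (mod v)`. (The computation behind O'Meara
63:11a/63:12 and Serre III.1 Thm. 1.) [folklore] -/
theorem isSquare_residue_of_hilbert_solution {p : v.adicCompletion K}
    (hp : Valued.v p = exp (-1 : ℤ)) {b : A} (hb : b ∉ v.asIdeal) {x y : v.adicCompletion K}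
    (h : p * x ^ 2 + algebraMap A (v.adicCompletion K) b * y ^ 2 = 1) :
    IsSquare (Ideal.Quotient.mk v.asIdeal b) := by
  haveI : v.asIdeal.IsMaximal := v.isMaximal
  letI : Field (A ⧸ v.asIdeal) := Ideal.Quotient.field v.asIdeal
  set B := algebraMap A (v.adicCompletion K) b with hB
  have hB1 : Valued.v B = 1 := valued_algebraMap_eq_one K v hb
  have hsum : Valued.v (p * x ^ 2 + B * y ^ 2) = 1 := by rw [h, map_one]
  -- Step 1: `v(y) = 1` and `v(p x²) < 1`
  have key : Valued.v y = 1 ∧ Valued.v (p * x ^ 2) < 1 := by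
    by_cases hx : x = 0
    · subst hx
      rw [zero_pow two_ne_zero, mul_zero, zero_add, map_mul, map_pow, hB1, one_mul] at hsum
      refine ⟨?_, by rw [zero_pow two_ne_zero, mul_zero, map_zero]; exact zero_lt_one⟩
      have hy0 : Valued.v y ≠ 0 := fun h0 ↦ by
        rw [h0, zero_pow two_ne_zero] at hsum; exact zero_ne_one hsum
      rw [← exp_log hy0, ← exp_nsmul, ← exp_zero, exp_inj, nsmul_eq_mul, Nat.cast_ofNat] at hsum
      rw [← exp_log hy0, ← exp_zero, exp_inj]
      omega
    by_cases hy : y = 0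
    · subst hy
      exfalso
      rw [zero_pow two_ne_zero, mul_zero, add_zero, map_mul, map_pow, hp] at hsum
      have hx0 : Valued.v x ≠ 0 := (Valuation.ne_zero_iff _).2 hx
      rw [← exp_log hx0, ← exp_nsmul, ← exp_add, ← exp_zero, exp_inj, nsmul_eq_mul, Nat.cast_ofNat] at hsum
      omega
    have hx0 : Valued.v x ≠ 0 := (Valuation.ne_zero_iff _).2 hx
    have hy0 : Valued.v y ≠ 0 := (Valuation.ne_zero_iff _).2 hy
    have hvx : Valued.v (p * x ^ 2) = exp (-1 + 2 * log (Valued.v x)) := by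
      rw [map_mul, map_pow, hp, ← exp_log hx0, ← exp_nsmul, ← exp_add, log_exp, nsmul_eq_mul, Nat.cast_ofNat]
    have hvy : Valued.v (B * y ^ 2) = exp (2 * log (Valued.v y)) := by
      rw [map_mul, map_pow, hB1, one_mul, ← exp_log hy0, ← exp_nsmul, log_exp, nsmul_eq_mul, Nat.cast_ofNat]
    have hne : Valued.v (p * x ^ 2) ≠ Valued.v (B * y ^ 2) := by
      rw [hvx, hvy, Ne, exp_inj]; omega
    rw [Valuation.map_add_of_distinct_val _ hne] at hsum
    rcases le_total (Valued.v (B * y ^ 2)) (Valued.v (p * x ^ 2)) with hle | hle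
    · rw [max_eq_left hle, hvx, ← exp_zero, exp_inj] at hsum
      omega
    · rw [max_eq_right hle] at hsum
      have hy1 : log (Valued.v y) = 0 := by
        rw [hvy, ← exp_zero, exp_inj] at hsum; omega
      refine ⟨by rw [← exp_log hy0, hy1, exp_zero], lt_of_le_of_ne (hsum ▸ hle) ?_⟩
      rw [hvx, ← exp_zero, Ne, exp_inj]
      omega
  obtain ⟨hy1, hpx⟩ := key
  -- Step 2: approximate `y` by `c ∈ A`
  obtain ⟨c, hc'⟩ := exists_valued_sub_algebraMap_lt_one K v hy1.le
  set C' := algebraMap A (v.adicCompletion K) c with hC'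
  have hCle : Valued.v C' ≤ 1 := valued_algebraMap_le_one K v c
  -- Step 3: `b c² - 1 = b (c - y)(c + y) - p x²` has valuation `< 1`
  have hmem : b * c ^ 2 - 1 ∈ v.asIdeal := by
    rw [← valued_algebraMap_lt_one_iff K v, map_sub, map_one, map_mul, map_pow, ← hB, ← hC',
      show B * C' ^ 2 - 1 = B * ((C' - y) * (C' + y)) - p * x ^ 2 by linear_combination h]
    refine Valuation.map_sub_lt _ ?_ hpx
    rw [map_mul, hB1, one_mul, map_mul]
    have hadd : Valued.v (C' + y) ≤ 1 := le_trans (Valuation.map_add _ _ _) (max_le hCle hy1.le)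
    calc Valued.v (C' - y) * Valued.v (C' + y) ≤ Valued.v (C' - y) * 1 := by gcongr
      _ < 1 := by rw [mul_one, Valuation.map_sub_swap]; exact hc'
  -- Step 4: read off `b ≡ (c⁻¹)² (mod v)`
  have hq : Ideal.Quotient.mk v.asIdeal b * Ideal.Quotient.mk v.asIdeal c ^ 2 = 1 := by
    rw [← map_pow, ← map_mul, ← (Ideal.Quotient.mk v.asIdeal).map_one, Ideal.Quotient.eq]
    exact hmem
  refine ⟨(Ideal.Quotient.mk v.asIdeal c)⁻¹, ?_⟩
  rw [← sq, inv_pow]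
  exact eq_inv_of_mul_eq_one_left hq

/-- The image in `K_v` of a uniformiser `π ∈ A` at `v` has valuation `exp (-1)`. [folklore] -/
theorem valued_algebraMap_uniformizer {π : A} (hπ : v.intValuation π = exp (-1 : ℤ)) :
    Valued.v (algebraMap A (v.adicCompletion K) π) = exp (-1 : ℤ) := by
  rw [valued_algebraMap K v, hπ]

/-- **`(π a, b)_v = 1` iff `b` is a square mod `v`** for `v` non-dyadic, `π ∈ A` a uniformiser at
`v`, `a b ∈ A ∖ v` (O'Meara, Example 63:12: "`(π, δ)_𝔭 = 1` if and only if `δ` is a square";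
for `K = ℚ`, `v = p` odd this is `(p a, b)_p = (b / p)`, Serre III.1 Thm. 1).
[cite: Omeara1963, §63 Example 63:12] -/
theorem hilbertSymbol_uniformizer_mul_iff (h2 : (2 : A) ∉ v.asIdeal) {π a b : A}
    (hπ : v.intValuation π = exp (-1 : ℤ)) (ha : a ∉ v.asIdeal) (hb : b ∉ v.asIdeal) :
    hilbertSymbol (v.adicCompletion K) (algebraMap A _ (π * a)) (algebraMap A _ b) = 1 ↔
      IsSquare (Ideal.Quotient.mk v.asIdeal b) := by
  constructor
  · intro h
    obtain ⟨x, y, hxy⟩ := (hilbertSymbol_eq_one_iff _ _).1 h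
    refine isSquare_residue_of_hilbert_solution K v ?_ hb hxy
    rw [map_mul, map_mul, valued_algebraMap_eq_one K v ha, mul_one]
    exact valued_algebraMap_uniformizer K v hπ
  · intro hsq
    exact hilbertSymbol_eq_one_of_isSquare_residue K v h2 hb hsq _

/-- **`(π a, π b)_v = 1` iff `-a b` is a square mod `v`** (`v` non-dyadic, `π` a uniformiser,
`a b ∈ A ∖ v`): `(π a, π b) = (π a, -(π a)(π b)) = (π a, -a b · π²) = (π a, -a b)` and the
previous rule (O'Meara 63:12 with §63B; Serre III.1 Thm. 1: `(p u, p v)_p = (-u v / p)`).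
[cite: Omeara1963, §63 Example 63:12] -/
theorem hilbertSymbol_uniformizer_mul_uniformizer_mul_iff (h2 : (2 : A) ∉ v.asIdeal) {π a b : A}
    (hπ : v.intValuation π = exp (-1 : ℤ)) (ha : a ∉ v.asIdeal) (hb : b ∉ v.asIdeal) :
    hilbertSymbol (v.adicCompletion K) (algebraMap A _ (π * a)) (algebraMap A _ (π * b)) = 1 ↔
      IsSquare (Ideal.Quotient.mk v.asIdeal (-(a * b))) := by
  haveI : v.asIdeal.IsPrime := v.isPrime
  haveI : NeZero (2 : v.adicCompletion K) :=
    ⟨by simpa only [map_ofNat] using algebraMap_adicCompletion_ne_zero K v h2⟩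
  have hab : -(a * b) ∉ v.asIdeal := by
    rw [Ideal.neg_mem_iff]
    exact fun h ↦ (Ideal.IsPrime.mem_or_mem ‹_› h).elim ha hb
  set P := algebraMap A (v.adicCompletion K) (π * a) with hP
  set α := algebraMap A (v.adicCompletion K) a with hα
  set β := algebraMap A (v.adicCompletion K) b with hβ
  have hα0 : α ≠ 0 := algebraMap_adicCompletion_ne_zero K v ha
  have hπ0 : algebraMap A (v.adicCompletion K) π ≠ 0 := by
    intro h0
    have h1 := valued_algebraMap_uniformizer K v hπ
    rw [h0, map_zero] at h1
    exact exp_ne_zero h1.symm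
  have hP0 : P ≠ 0 := by
    rw [hP, map_mul]; exact mul_ne_zero hπ0 hα0
  -- `(P, π b) = (P, -(P · (-b/a))) = (P, -b/a) = (P, -a b · (a⁻¹)²) = (P, -a b)`
  have h1 : algebraMap A (v.adicCompletion K) (π * b) = -(P * (-(β / α))) := by
    rw [hP, map_mul, map_mul, ← hα, ← hβ]
    field_simp
  have h3 : -(β / α) = algebraMap A (v.adicCompletion K) (-(a * b)) * α⁻¹ ^ 2 := by
    rw [map_neg, map_mul, ← hα, ← hβ]
    field_simp
  rw [h1, hilbertSymbol_neg_mul_right hP0, h3, hilbertSymbol_mul_sq_right _ _ (inv_ne_zero hα0),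
    hP]
  exact hilbertSymbol_uniformizer_mul_iff K v h2 hπ ha hab

end Local

end Literature.NumberTheory.QuadraticForms
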